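import Summits.BirchSwinnertonDyer.Rank1Residual.Additive.GoodModelReductionSign
import Summits.BirchSwinnertonDyer.Rank1Residual.Additive.RamifiedOrdinaryLineExponent
import Summits.BirchSwinnertonDyer.Rank1Residual.Additive.RamifiedOrdinaryLineInertiaScalars
import HarnessLib

/-!
# The HALF-POWER of inertia on the ramified ordinary line, CORE: a SIGN on the quotient gives
# `σ^{(p−1)/2} = 1` on `C[p]` (model-free), and the Kummer–Deuring model line HAS the sign
# (cell `b2b-bsdres`, team n1011, seat p16 (gen 7); row T-QEXP FILE Q3 — the two halves of the
# (P-e46-odd) producer, assembled in `Additive/RamifiedOrdinaryLineHalfPower.lean` (Q4) into the `hℓ`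
# supply at `ℓ = (p−1)/2` for cc-typer-2's S4 `RamifiedOrdinaryLineMatchingLineExponent`)

HONEST FRAMING (cell `b2b-bsdres`, run/shared/lean/b2b/bsd-rank1-residual/, verbatim in every
file): the goal of the cell is to DELETE the COMBINATION-SHAPED residual classes of the
Birch–Swinnerton-Dyer formula for ALL analytic-rank `≤ 1` elliptic curves over `ℚ` — "full BSD
formula for every rank `≤ 1` curve in class `C`" assembled STRICTLY from published theorems — so
that the rank-`≤ 1` remainder becomes exactly the CONSTRUCTION-SHAPED classes, which are TYPED
(missing-input `Prop`s), NOT attempted. This is not "finishing BSD". Team n1011 (N10/N11): research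
route on the CONSTRUCTION-SHAPED classes X3♯(G-ord)/X4♯(G-ord); prove what is provable now; no
claim beyond stated classes; census output = EVIDENCE, never a Literature fact; RESIDUAL-MAP marks
UNCHANGED; nothing is booked by this file. TOOL theorems only: NO definition, NO named fact, NO
conjecture node; 0 hypotheses beyond `TypeGOrd`, `Addv`, `5 ≤ p`, the parity side conditions on
`e`, `p ∈ v` and the line itself.

## What and why

cc-typer-2's S4 matches the ramified ordinary lines `C ⊂ E[p^∞]`, `C₁ ⊂ E₁[p^∞]` of an
equal-parity congruence link ON the swap locus `(p−1) ∣ lcm(e, e₁)` from the LINE half-powers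
`hℓ : ∀ σ ∈ I_v, ∀ m ∈ C, p·m = 0 → σ^{(p−1)/2} m = m` on both members; its live customers (the
(5;4,4) and (7;6,6) CONG links of class-closure N10) were "all modulo ONE producer (P-e46-odd): the
EXACT order `e` of the quotient character, not in the tree" (`N10/TRANSPORT-TEMPLATE.md` v2.1).
This file produces `hℓ` WITHOUT the exact order. Write `ψ₁`, `ψ₂ : I_v → 𝔽_p^×` for the characters
of inertia on `C[p]` and on `E[p]/C[p]`. Then `ψ₁ψ₂ = χ̄_p` (Weil pairing), and the QUADRATIC PART
of `ψ₂` is `ψ₂^{e/2} = (χ̄_p/p)` (Legendre symbol) — because on p07's Kummer–Deuring model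
(`C = ⟨u, r, s, t⟩`, `u^e = p^m`, `m` odd) `σ^{e/2}` multiplies `u` by `σ(√p)/√p = (χ̄_p(σ)/p)`
(Q2 `pow_div_two_smul_eq_legendre_mul`, Gauss sum) and therefore acts on the reduction through the
reduced automorphism `[±1]` (Q2 `goodReductionHom_pointEquiv_map_eq_neg_of_map_eq`, F-A1). Euler's
criterion `(c/p) = c^{(p−1)/2}` then gives `ψ₁^{(p−1)/2} = (χ̄_p/p)^{1+(p−1)/e} = 1` exactly when
`(p−1)/e` is odd:

* §A (MODEL-FREE core, any ramified ordinary line, any `n`, `k` odd with `nk = (p−1)/2`)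
  **`IsRamifiedOrdinaryLine.lineHalfPow_of_quotSign`**: if `σ^n` acts on `E[p^∞]` modulo `C` as the
  sign `(χ̄_p(σ)/p)` for every inertial `σ`, then `hℓ` at `(p−1)/2` (cc-typer-2's scalar calculus
  `RamifiedOrdinaryLineInertiaScalars` + `modNCyclotomicCharacter_eq_of_smul_eq_pow` + Euler);
* §B **`GoodModelLine.pow_smul_sub_sign_smul_mem_plus`**: on the datum of a SHORT good model
  `C • E ⊗ K̄_v = W₀ ⊗ K̄_v` with `σ(C) = ⟨σu/u, 0, 0, 0⟩·C`, `u^e = p^m` (`e` even, `m` odd, `p ∤ e`),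
  `σ^{e/2}` acts modulo `C` as the sign `(χ̄_p(σ)/p)`.
The END (`TypeGOrd`, `2 ∣ e`, `e ≠ 2`, `¬ 2 ∣ (p−1)/e`, any ramified ordinary line) and the class
forms are FILE Q4 `Additive/RamifiedOrdinaryLineHalfPower.lean`.

HONEST LIMIT: the cube part of the exact order of `ψ₂` (`e ∈ {3, 6}`) is not needed and not proved;
nothing is claimed on MIXED-parity links; `e = 2` rows are cc-typer-2's (P-def2-odd).

References: J.-P. Serre, J. Tate, Ann. of Math. 88 (1968) §2 [SerreTate1968]; J.-P. Serre, Invent.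
Math. 15 (1972) §1.11–1.12, §5.6 [Serre1972]; R. Greenberg, V. Vatsal, Invent. Math. 142 (2000) §2
p. 26 [GreenbergVatsal2000]; M. Emerton, R. Pollack, T. Weston, Invent. Math. 163 (2006) §3.1
[EmertonPollackWeston2006]; J. H. Silverman, *AEC* III.8.1, VII.2.1, VII.5.5 [SilvermanAEC2009];
cells/n1011/skel/T-QEXP.md (9035fb2cb670ba82); class-closure/N10/TRANSPORT-TEMPLATE.md v2.1
§PRODUCERS (P-e46-odd).
-/

set_option autoImplicit false

noncomputable section

open scoped Classical NNReal NumberField AddSubgroup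

open WeierstrassCurve

universe u

/-! ## §A The model-free core: a SIGN on the quotient at exponent `n` gives `hℓ` at `(p−1)/2 = nk`, `k` odd -/

namespace Literature.NumberTheory.EllipticCurves.EmertonPollackWeston2006.IsRamifiedOrdinaryLine

open NumberField IsDedekindDomain Field IsDedekindDomain.HeightOneSpectrum
  Literature.NumberTheory.GaloisRepresentations Literature.NumberTheory.EllipticCurves
  Literature.NumberTheory.EllipticCurves.GreenbergSelmer
  Summit.BirchSwinnertonDyer.Rank1Residual.Additive.RamifiedOrdinaryLineInertiaScalars

variable {W : WeierstrassCurve ℚ} [W.IsElliptic] {p : ℕ} [hp : Fact p.Prime]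
  {v : HeightOneSpectrum (𝓞 ℚ)}

/-- **`hℓ` at `(p−1)/2` from a SIGN on the quotient (model-free).** Let `C = L.plus` be a ramified
ordinary line of `E[p^∞]` at `v ∋ p` (`p` odd), and `n`, `k` with `k` odd and `nk = (p−1)/2`. Suppose
that for every local inertia element `σ`, `σⁿ` acts on `E[p^∞]` modulo `C` as the scalar
`(χ̄_p(σ)/p) ∈ {±1}` (Legendre symbol of the mod `p` cyclotomic character). Then `σ^{(p−1)/2}`
fixes `C ∩ E[p^∞][p]` pointwise for every inertial `σ`. Proof: line scalar `a`, quotient scalar `b`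
(`exists_lineScalar`, `exists_quotScalar`); the Weil pairing gives `ba = χ̄_p(σ) =: c` in `ℤ/p`
(`exists_isPrimitiveRoot_smul_eq_pow_quotScalar_mul_lineScalar`,
`modNCyclotomicCharacter_eq_of_smul_eq_pow`); the hypothesis gives `bⁿ = (c/p) = c^{(p−1)/2}`
(Euler); hence `a^{(p−1)/2} = (aⁿ)^k = ((c/p) cⁿ)^k = (c/p)^{k+1} = 1`.
[cite: GreenbergVatsal2000, §2 p. 26] [cite: SilvermanAEC2009, Prop. III.8.1] -/
theorem lineHalfPow_of_quotSign [NeZero ((p : ℕ) : v.adicCompletion ℚ)]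
    {L : LocalDatum ℚ (W.geomPrimaryTorsion p) v} (hL : IsRamifiedOrdinaryLine W p L) (hp2 : p ≠ 2)
    {n k : ℕ} (hk : Odd k) (hnk : n * k = (p - 1) / 2)
    (hsign : ∀ σ ∈ absInertia (v.adicCompletion ℚ), ∀ y : W.geomPrimaryTorsion p,
      (absGaloisRestrict ℚ (v.adicCompletion ℚ) σ) ^ n • y -
        (quadraticChar (ZMod p)
          ((modNCyclotomicCharacter (v.adicCompletion ℚ) p σ : (ZMod p)ˣ) : ZMod p) : ℤ) • y ∈ L.plus) :
    ∀ σ ∈ absInertia (v.adicCompletion ℚ), ∀ m ∈ L.plus, p • m = 0 →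
      (absGaloisRestrict ℚ (v.adicCompletion ℚ) σ) ^ ((p - 1) / 2) • m = m := by
  intro σ hσ m hm hpm
  haveI : Fact (1 < p) := ⟨hp.out.one_lt⟩
  set g := absGaloisRestrict ℚ (v.adicCompletion ℚ) σ with hg
  have hcomm : ∀ (j : ℕ) (z : W.geomPrimaryTorsion p), g • (j • z) = j • (g • z) := fun j z ↦
    map_nsmul (DistribSMul.toAddMonoidHom (W.geomPrimaryTorsion p) g) j z
  -- the scalars
  obtain ⟨a, ha⟩ := exists_lineScalar hL σ
  obtain ⟨x, hx0, hxp, hxgen⟩ := exists_quotGenerator hL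
  obtain ⟨b, hbx, hb⟩ := exists_quotScalar σ hxp hxgen
  -- Weil pairing: `b a = χ̄_p(σ)` in `ℤ/p`
  obtain ⟨ζ, hζ, hζσ⟩ := exists_isPrimitiveRoot_smul_eq_pow_quotScalar_mul_lineScalar hL σ ha hb
  rw [pow_one] at hζ
  set c : ZMod p := ((modNCyclotomicCharacter (v.adicCompletion ℚ) p σ : (ZMod p)ˣ) : ZMod p) with hc
  have hcba : c = ((b * a : ℕ) : ZMod p) :=
    modNCyclotomicCharacter_eq_of_smul_eq_pow (v.adicCompletion ℚ) p hζ σ hζσ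
  have hc0 : c ≠ 0 := Units.ne_zero _
  -- the sign `ε = (c/p)`, `ε² = 1`, Euler `ε = c^{(p−1)/2}`
  set ε : ℤ := quadraticChar (ZMod p) c with hε
  have hpchar : ringChar (ZMod p) ≠ 2 := by rwa [ZMod.ringChar_zmod_n]
  have hεeuler : (ε : ZMod p) = c ^ ((p - 1) / 2) := by
    rw [hε, quadraticChar_eq_pow_of_char_ne_two' hpchar c, ZMod.card]
    congr 1
    have := Nat.odd_iff.mp (hp.out.odd_of_ne_two hp2)
    omega
  have hε2 : (ε : ZMod p) ^ 2 = 1 := by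
    rw [hε, ← Int.cast_pow, quadraticChar_sq_one hc0, Int.cast_one]
  -- iterate the quotient scalar: `grMk (g^j • x) = b^j • grMk x`
  have hgC : ∀ z ∈ L.plus, L.grMk (g • z) = 0 := fun z hz ↦ by
    rw [← AddMonoidHom.mem_ker, L.ker_grMk]; exact L.smul_mem σ hz
  have hpow : ∀ j : ℕ, L.grMk (g ^ j • x) = b ^ j • L.grMk x := by
    intro j
    induction j with
    | zero => rw [pow_zero, one_smul, pow_zero, one_nsmul]
    | succ j ih =>
      have hcz : g ^ j • x - b ^ j • x ∈ L.plus := by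
        rw [← L.ker_grMk, AddMonoidHom.mem_ker, map_sub, map_nsmul, ih, sub_self]
      have hstep : g ^ (j + 1) • x = b ^ j • (g • x) + g • (g ^ j • x - b ^ j • x) := by
        rw [pow_succ', mul_smul, smul_sub, hcomm, add_sub_cancel]
      rw [hstep, map_add, hgC _ hcz, add_zero, map_nsmul, hbx, ← mul_nsmul', ← pow_succ]
  -- the hypothesis: `grMk (g^n • x) = ε • grMk x`, so `b^n = ε` in `ℤ/p`
  have hsignx := hsign σ hσ x
  rw [← L.ker_grMk, AddMonoidHom.mem_ker, map_sub, map_zsmul, hpow n] at hsignx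
  have hordx : addOrderOf (L.grMk x) = p := addOrderOf_eq_prime hxp hx0
  have hbn : ((b : ZMod p)) ^ n = (ε : ZMod p) := by
    have hz : (((b ^ n : ℕ) : ℤ) - ε) • L.grMk x = 0 := by
      rw [sub_smul, natCast_zsmul]; exact hsignx
    have hdvd : (p : ℤ) ∣ ((b ^ n : ℕ) : ℤ) - ε := by
      rw [← hordx]; exact (addOrderOf_dvd_iff_zsmul_eq_zero).mpr hz
    have h0 : ((((b ^ n : ℕ) : ℤ) - ε : ℤ) : ZMod p) = 0 :=
      (ZMod.intCast_zmod_eq_zero_iff_dvd _ p).mpr hdvd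
    rw [Int.cast_sub, sub_eq_zero, Int.cast_natCast, Nat.cast_pow] at h0
    exact h0
  -- `a^{(p−1)/2} = 1` in `ℤ/p`
  have hapow : ((a : ZMod p)) ^ ((p - 1) / 2) = 1 := by
    have han : (a : ZMod p) ^ n = (ε : ZMod p) * c ^ n := by
      have h1 : c ^ n = (ε : ZMod p) * (a : ZMod p) ^ n := by
        rw [hcba, Nat.cast_mul, mul_pow, hbn]
      rw [h1, ← mul_assoc, ← sq, hε2, one_mul]
    obtain ⟨j, hj⟩ := hk
    calc (a : ZMod p) ^ ((p - 1) / 2) = ((a : ZMod p) ^ n) ^ k := by rw [← pow_mul, hnk]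
      _ = (ε : ZMod p) ^ (k + 1) * (ε : ZMod p) ^ 2 := by
          rw [han, mul_pow, ← pow_mul, hnk, ← hεeuler, pow_succ, hε2, mul_one]
      _ = 1 := by
          rw [hε2, mul_one, hj, show 2 * j + 1 + 1 = 2 * (j + 1) by ring, pow_mul, hε2, one_pow]
  -- iterate the line scalar: `g^j • m = a^j • m`
  have hline : ∀ j : ℕ, g ^ j • m = a ^ j • m := by
    intro j
    induction j with
    | zero => rw [pow_zero, one_smul, pow_zero, one_nsmul]
    | succ j ih =>
      have hajm : a ^ j • m ∈ L.plus := L.plus.nsmul_mem hm _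
      have hajp : p • (a ^ j • m) = 0 := by rw [smul_comm, hpm, smul_zero]
      rw [pow_succ', mul_smul, ih, ha _ hajm hajp, ← mul_nsmul', ← pow_succ']
  -- conclude: `a^{(p−1)/2} ≡ 1 (mod p)` and `p • m = 0`
  have hmod : a ^ ((p - 1) / 2) % p = 1 := by
    have h := congrArg ZMod.val hapow
    rwa [← Nat.cast_pow, ZMod.val_natCast, ZMod.val_one] at h
  rw [hline, ← Nat.div_add_mod (a ^ ((p - 1) / 2)) p, hmod, add_nsmul, one_nsmul, mul_comm,
    mul_nsmul', hpm, smul_zero, zero_add]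

end Literature.NumberTheory.EllipticCurves.EmertonPollackWeston2006.IsRamifiedOrdinaryLine

/-! ## §B The model line: `σ^{e/2}` acts modulo `C` as the sign `(χ̄_p(σ)/p)` -/

namespace Summit.BirchSwinnertonDyer.Rank1Residual.Additive.GoodModelLine

open NumberField IsDedekindDomain Field IsDedekindDomain.HeightOneSpectrum
  Literature.NumberTheory.GaloisRepresentations Literature.NumberTheory.EllipticCurves
  Literature.NumberTheory.EllipticCurves.GreenbergSelmer
  Literature.NumberTheory.EllipticCurves.EmertonPollackWeston2006
  Literature.NumberTheory.EllipticCurves.Rank1Residual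
  Literature.NumberTheory.EllipticCurves.Rank1Residual.Typed
  Summit.BirchSwinnertonDyer.Rank1Residual.X2.GreenbergVatsalReductionDatum

section Sign

variable (W : WeierstrassCurve ℚ) [W.IsElliptic] (p : ℕ) [hp : Fact p.Prime]
  {v : HeightOneSpectrum (𝓞 ℚ)}
  {C : VariableChange (AlgebraicClosure (v.adicCompletion ℚ))}
  {W₀ : WeierstrassCurve (specVal v).integer}
  (hW₀ : C • (W.baseChange (v.adicCompletion ℚ)).baseChange (AlgebraicClosure (v.adicCompletion ℚ)) =
    W₀.baseChange (AlgebraicClosure (v.adicCompletion ℚ)))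
  (hΔ : IsUnit W₀.Δ)
  (red : localPoints W (v.adicCompletion ℚ) →+
    (W₀.map (IsLocalRing.residue (specVal v).integer)).toAffine.Point)
  (hred : ∀ P, red P = goodReductionHom W₀ (Valuation.integer.integers (specVal v)) hΔ
    (Affine.Point.congrEquiv hW₀ (VariableChange.pointEquiv _ C
      (Affine.Point.congrEquiv (baseChange_baseChange_adicCompletion W v).symm P))))
  (Lv : LocalDatum ℚ (W.geomPrimaryTorsion p) v)
  (hLv : ∀ m, m ∈ Lv.plus ↔ red (pointsMap W (v.adicCompletion ℚ) (m : W.geomPoints)) = 0)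

omit [W.IsElliptic] in
include hred hLv in
/-- **On the datum of a short Kummer–Deuring good model, `σ^{e/2}` acts on `E[p^∞]` modulo `C` as
the sign `(χ̄_p(σ)/p)`.** In p05's F-A setting (good model `W₀ = C • E ⊗ K̄_v`, the datum `Lv` with
`m ∈ C ↔ red_{W₀}(Φ_C(ι m)) = 0`), assume `W₀` short (`a₁ = a₃ = 0`) and `σ(C) = ⟨η, 0, 0, 0⟩ · C`
whenever `σ(u) = η u`, for a Kummer element `u` with `u^e = p^m`, `e` even, `p ∤ e`, `m` odd (Q1
`exists_kummerGoodModel_explicit`). Then for every local inertia element `σ` and every `y ∈ E[p^∞]`: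
`σ^{e/2} y − (χ̄_p(σ)/p) y ∈ C`. (`σ^{e/2}(u) = (χ̄_p(σ)/p) u` by Q2 `pow_div_two_smul_eq_legendre_mul`;
the reduced change of variables of `σ^{e/2}` is `[±1]`: F-A1
`goodReductionHom_pointEquiv_map_eq_of_map_eq` / Q2 `goodReductionHom_pointEquiv_map_eq_neg_of_map_eq`.)
[cite: SerreTate1968, §2 Thm. 2 (mechanism of proof)] [cite: SilvermanAEC2009, Prop. VII.2.1] -/
theorem pow_smul_sub_sign_smul_mem_plus [NeZero ((p : ℕ) : v.adicCompletion ℚ)] (hp2 : p ≠ 2)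
    (hpv : ((p : ℕ) : 𝓞 ℚ) ∈ v.asIdeal) (ha₁ : W₀.a₁ = 0) (ha₃ : W₀.a₃ = 0)
    {u : AlgebraicClosure (v.adicCompletion ℚ)} {e m : ℕ} (he0 : e ≠ 0) (h2e : 2 ∣ e)
    (hpe : ¬ p ∣ e) (hm : Odd m) (hu : u ^ e = (p : AlgebraicClosure (v.adicCompletion ℚ)) ^ m)
    (hC : ∀ (ψ : AlgebraicClosure (v.adicCompletion ℚ) ≃ₐ[v.adicCompletion ℚ]
        AlgebraicClosure (v.adicCompletion ℚ)) (η : (AlgebraicClosure (v.adicCompletion ℚ))ˣ),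
      ψ u = η * u →
        C.map (ψ : AlgebraicClosure (v.adicCompletion ℚ) →+* AlgebraicClosure (v.adicCompletion ℚ)) =
          (⟨η, 0, 0, 0⟩ : VariableChange (AlgebraicClosure (v.adicCompletion ℚ))) * C) :
    ∀ σ ∈ absInertia (v.adicCompletion ℚ), ∀ y : W.geomPrimaryTorsion p,
      (absGaloisRestrict ℚ (v.adicCompletion ℚ) σ) ^ (e / 2) • y -
        (quadraticChar (ZMod p)
          ((modNCyclotomicCharacter (v.adicCompletion ℚ) p σ : (ZMod p)ˣ) : ZMod p) : ℤ) • y ∈ Lv.plus := by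
  obtain ⟨𝔐, h𝔐⟩ := v.localPrimesAbove_nonempty
  intro σ hσ y
  set τ : absoluteGaloisGroup (v.adicCompletion ℚ) := σ ^ (e / 2) with hτ
  have hτI : τ ∈ absInertia (v.adicCompletion ℚ) := Subgroup.pow_mem _ hσ _
  have hτI' : τ ∈ 𝔐.inertia (absoluteGaloisGroup (v.adicCompletion ℚ)) := by
    rw [inertia_eq_absInertia (specVal_spec v) h𝔐]; exact hτI
  have hmove := (mem_inertia_iff_spectralValuation (specVal_spec v) h𝔐).1 hτI'
  set ψ : AlgebraicClosure (v.adicCompletion ℚ) ≃ₐ[v.adicCompletion ℚ]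
      AlgebraicClosure (v.adicCompletion ℚ) := absoluteGaloisGroup.toAlgEquiv _ τ with hψ
  -- the sign `ε = (χ̄_p(σ)/p) ∈ {±1}` and `τ u = ε u`
  set c : ZMod p := ((modNCyclotomicCharacter (v.adicCompletion ℚ) p σ : (ZMod p)ˣ) : ZMod p) with hc
  set ε : ℤ := quadraticChar (ZMod p) c with hε
  have hτu : ψ u = ((ε : ℤ) : AlgebraicClosure (v.adicCompletion ℚ)) * u := by
    rw [hψ, ← absoluteGaloisGroup.smul_def, hτ]
    exact pow_div_two_smul_eq_legendre_mul p hp2 hpv he0 h2e hpe hm hu hσ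
  have hεcases : ε = 1 ∨ ε = -1 := quadraticChar_dichotomy (Units.ne_zero _)
  -- `red (τ • P) = ε • red P` for every `P ∈ E(K̄_v)`
  have key : ∀ P : localPoints W (v.adicCompletion ℚ), red (τ • P) = ε • red P := by
    intro P
    rw [hred, hred, congrEquiv_smul W v τ]
    rcases hεcases with h1 | h1
    · have hCψ : C.map (ψ : AlgebraicClosure (v.adicCompletion ℚ) →+*
          AlgebraicClosure (v.adicCompletion ℚ)) = C := by
        have h := hC ψ 1 (by rw [hτu, h1, Units.val_one, Int.cast_one])
        rw [h, ← VariableChange.one_def, one_mul]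
      rw [h1, one_zsmul]
      exact goodReductionHom_pointEquiv_map_eq_of_map_eq (W.baseChange (v.adicCompletion ℚ)) C hW₀ hΔ
        ψ (fun z ↦ spectralValuation_smul (specVal_spec v) τ z) hmove hCψ _
    · have hCψ : C.map (ψ : AlgebraicClosure (v.adicCompletion ℚ) →+*
          AlgebraicClosure (v.adicCompletion ℚ)) =
            (⟨-1, 0, 0, 0⟩ : VariableChange (AlgebraicClosure (v.adicCompletion ℚ))) * C :=
        hC ψ (-1) (by rw [hτu, h1, Units.val_neg, Units.val_one, Int.cast_neg, Int.cast_one])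
      rw [h1, neg_one_zsmul]
      exact goodReductionHom_pointEquiv_map_eq_neg_of_map_eq (W.baseChange (v.adicCompletion ℚ)) C hW₀
        hΔ ψ (fun z ↦ spectralValuation_smul (specVal_spec v) τ z) hmove ha₁ ha₃ hCψ _
  -- transport to `E[p^∞]`
  rw [hLv, ← map_pow, ← hτ, AddSubgroupClass.coe_sub, primaryComponent.coe_smul,
    AddSubgroupClass.coe_zsmul, map_sub, map_zsmul, pointsMap_absGaloisRestrict_smul, map_sub,
    map_zsmul, key, sub_self]

end Sign

end Summit.BirchSwinnertonDyer.Rank1Residual.Additive.GoodModelLine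

end
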